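import Mathlib.Analysis.Calculus.MeanValue
import Mathlib.Analysis.Convex.Star
import Mathlib.MeasureTheory.Function.LpSpace.Complete
import Mathlib.MeasureTheory.Integral.IntervalIntegral.FundThmCalculus
import Mathlib.MeasureTheory.Measure.Lebesgue.EqHaar
import Literature.Analysis.FunctionSpaces.SobolevTrace
import Literature.Analysis.FunctionSpaces.LipschitzDomainCover
import Literature.Analysis.FunctionSpaces.MollificationLocal
import Literature.Analysis.FunctionSpaces.PoincareGluing
import HarnessLib

/-!
# Proofs for `Literature/Analysis/FunctionSpaces/SobolevTrace`: the Poincaré–Wirtinger inequality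

Discharge of the named fact `Literature.Analysis.FunctionSpaces.poincare_wirtinger` (the Poincaré–Wirtinger inequality on
bounded connected Lipschitz domains, Evans, *PDE*, §5.8.1, Theorem 1) by the theorem
`Literature.Analysis.FunctionSpaces.poincare_wirtinger_holds` (last section). Sibling proof file of `SobolevTrace`, next to
`SobolevTraceProofs` (Morrey's embedding) and `SobolevTraceDensityProofs`.

The accepted fact is stated for functions with values in an arbitrary real Banach space `F` and
for `1 ≤ p ≤ ∞`. Evans's proof (contradiction + Rellich–Kondrachov compactness) does not cover
infinite-dimensional `F`, so the discharge follows instead the constructive route of Maz'ya,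
*Sobolev Spaces* (1985), §1.1.9–§1.1.11, which is insensitive to the target space:

1. a bounded Lipschitz domain is a finite union of bounded open pieces, each star-shaped with
   respect to a ball (`Literature.Analysis.FunctionSpaces.IsLipschitzDomain.exists_finite_starConvex_cover`, accepted file
   `LipschitzDomainCover`; Maz'ya §1.1.9, Lemma 1);
2. on each piece the Poincaré inequality holds by the potential estimate
   (`Literature.Analysis.FunctionSpaces.poincare_starShaped`, this file; Maz'ya §1.1.11, Lemma; Gilbarg–Trudinger (7.45));
3. the estimates on the pieces are glued along chains of overlapping pieces, using the
   connectedness of `Ω` (`Literature.Analysis.FunctionSpaces.exists_eLpNorm_sub_setAverage_le_of_finite_cover`, accepted file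
   `PoincareGluing`; Maz'ya §1.1.11, end of the proof of the Lemma).

## The Poincaré inequality on bounded domains star-shaped with respect to a ball

The bulk of the file is step 2. We prove, for an additive Haar measure `μ` on a
finite-dimensional real inner product space `E`, a real Banach space `F`, `1 ≤ p ≤ ∞`, and a
bounded open set `U` containing a ball `B(a, r)` such that `U` is star-shaped with respect to
every point of `B(a, r)`:

`‖f - ⨍_U f‖_{L^p(U)} ≤ C ‖g‖_{L^p(U)}` for every `f ∈ L^p(U; F)` with weak derivative `g` on
`U` (`Literature.Analysis.FunctionSpaces.poincare_starShaped`), with `C` depending only on `U`, `a`, `r`, `p`, `μ`.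

This is Maz'ya, *Sobolev Spaces* (1985), §1.1.11, Lemma (`‖u - ū‖_{L_p(Ω)} ≤ C ‖∇u‖_{L_p(Ω)}`
for domains star-shaped with respect to a ball; also Gilbarg–Trudinger, (7.45)). The proof is
the classical potential estimate, organised so that it works verbatim for Banach-space valued
functions and all `1 ≤ p ≤ ∞`:

1. (`Literature.Analysis.FunctionSpaces.eLpNorm_prod_sub_le_of_contDiff`) for `u ∈ C¹(E; F)`, integrating `Du` along the
   segments from `y ∈ B` to `x ∈ U` and changing variables `x ↦ (1-t)x + ty` (`t ≤ 1/2`) resp.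
   `y ↦ (1-t)x + ty` (`t ≥ 1/2`) under the Haar measure gives the two-point estimate
   `‖u(x) - u(y)‖_{L^p(U × B)} ≤ d · 2^{n/p} μ(U)^{1/p} ‖Du‖_{L^p(U)}`, `d = diam U + 1`,
   `n = dim E` (Gilbarg–Trudinger, proof of Lemma 7.16; Maz'ya §1.1.10, Theorem 1);
2. (`Literature.Analysis.FunctionSpaces.eLpNorm_prod_sub_le_of_hasWeakFDerivOn`) for `f` with weak derivative `g` the same
   two-point estimate follows by interior mollification (accepted file `MollificationLocal`: on
   the inner parallel set `U_δ` the mollification `φ_ε ⋆ 𝟙_U f` is smooth with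
   `‖D(φ_ε ⋆ 𝟙_U f)‖_{L^p(U_δ)} ≤ ‖g‖_{L^p(U)}`, and `U_δ` is again star-shaped with respect to
   `B(a, r/2)`), Lebesgue points (`φ_ε ⋆ 𝟙_U f → f` a.e.) and Fatou's lemma in `L^p`, first
   for `ε → 0` and then for `δ → 0`;
3. (`Literature.Analysis.FunctionSpaces.eLpNorm_sub_setAverage_le_of_prod`) averaging over `y ∈ B` (Jensen) bounds
   `‖f - ⨍_B f‖_{L^p(U)}` by `μ(B)^{-1/p}` times the two-point norm, and
   `‖f - ⨍_U f‖_{L^p(U)} ≤ 2 ‖f - ⨍_B f‖_{L^p(U)}` (accepted file `PoincareGluing`).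

## References

* L. C. Evans, *Partial Differential Equations*, 2nd ed. (2010), §5.8.1, Theorem 1 (and §5.3.1
  for interior mollification).
* V. G. Maz'ja, *Sobolev Spaces*, Springer Series in Soviet Mathematics (1985), §1.1.9–1.1.11.
* D. Gilbarg, N. S. Trudinger, *Elliptic Partial Differential Equations of Second Order*,
  Classics in Mathematics (2001), §7.8, Lemma 7.16 and (7.45).
-/

noncomputable section

open MeasureTheory TopologicalSpace Set Function Filter Topology Metric ContinuousLinearMap
open scoped ENNReal NNReal Convolution

namespace Literature.Analysis.FunctionSpaces

/-! ### Averaging: from two-point estimates to deviations from the mean -/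

section Averaging

variable {α : Type*} [MeasurableSpace α] {μ : Measure α}
variable {F : Type*} [NormedAddCommGroup F] [NormedSpace ℝ F] [CompleteSpace F]

/-- `‖a - ⨍_B f‖ₑ ≤ μ(B)⁻¹ ∫⁻_B ‖a - f y‖ₑ dy` for `0 < μ B < ∞` and `f` integrable on `B`
(the average of `a - f` is `a - ⨍ f`). [folklore] -/
theorem enorm_sub_setAverage_le {B : Set α} (hB0 : μ B ≠ 0) (hBt : μ B ≠ ∞) {f : α → F}
    (hf : IntegrableOn f B μ) (a : F) :
    ‖a - ⨍ y in B, f y ∂μ‖ₑ ≤ (μ B)⁻¹ * ∫⁻ y in B, ‖a - f y‖ₑ ∂μ := by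
  have hreal : 0 < μ.real B := ENNReal.toReal_pos hB0 hBt
  have h1 : a - ⨍ y in B, f y ∂μ = -⨍ y in B, (f y - a) ∂μ := by
    rw [setAverage_sub_const hB0 hBt hf a, neg_sub]
  rw [h1, enorm_neg, setAverage_eq, enorm_smul, Real.enorm_of_nonneg (inv_nonneg.2 hreal.le),
    ENNReal.ofReal_inv_of_pos hreal, measureReal_def, ENNReal.ofReal_toReal hBt]
  gcongr
  refine (enorm_integral_le_lintegral_enorm _).trans_eq ?_
  simp_rw [enorm_sub_rev]

/-- **Jensen step of the averaging argument**, `1 ≤ q < ∞`: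
`∫_S ‖f x - ⨍_B f‖^q dx ≤ μ(B)⁻¹ ∫_{S × B} ‖f x - f y‖^q d(x, y)`. [folklore] -/
theorem lintegral_enorm_sub_setAverage_rpow_le [SFinite μ] {S B : Set α} (hB0 : μ B ≠ 0)
    (hBt : μ B ≠ ∞)
    {f : α → F} (hfB : IntegrableOn f B μ) (hfS : AEStronglyMeasurable f (μ.restrict S))
    {q : ℝ} (hq : 1 ≤ q) :
    ∫⁻ x in S, ‖f x - ⨍ y in B, f y ∂μ‖ₑ ^ q ∂μ ≤
      (μ B)⁻¹ * ∫⁻ z, ‖f z.1 - f z.2‖ₑ ^ q ∂((μ.restrict S).prod (μ.restrict B)) := by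
  have hq0 : 0 ≤ q := by linarith
  -- pointwise Jensen bound
  have hpt : ∀ x, ‖f x - ⨍ y in B, f y ∂μ‖ₑ ^ q ≤ (μ B)⁻¹ * ∫⁻ y in B, ‖f x - f y‖ₑ ^ q ∂μ := by
    intro x
    have hFm : AEMeasurable (fun y => ‖f x - f y‖ₑ) (μ.restrict B) :=
      (aestronglyMeasurable_const.sub hfB.aestronglyMeasurable).enorm
    have hJ := UnboundedOperators.lintegral_mul_rpow_le_of_one_le (μ := μ.restrict B) (K := fun _ => 1)
      (F := fun y => ‖f x - f y‖ₑ) aemeasurable_const hFm hq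
    simp only [one_mul, lintegral_const, Measure.restrict_apply_univ] at hJ
    calc ‖f x - ⨍ y in B, f y ∂μ‖ₑ ^ q ≤ ((μ B)⁻¹ * ∫⁻ y in B, ‖f x - f y‖ₑ ∂μ) ^ q :=
          ENNReal.rpow_le_rpow (enorm_sub_setAverage_le hB0 hBt hfB (f x)) hq0
      _ = (μ B)⁻¹ ^ q * (∫⁻ y in B, ‖f x - f y‖ₑ ∂μ) ^ q := ENNReal.mul_rpow_of_nonneg _ _ hq0
      _ ≤ (μ B)⁻¹ ^ q * (μ B ^ (q - 1) * ∫⁻ y in B, ‖f x - f y‖ₑ ^ q ∂μ) := by gcongr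
      _ = (μ B)⁻¹ * ∫⁻ y in B, ‖f x - f y‖ₑ ^ q ∂μ := by
          rw [← mul_assoc, ENNReal.inv_rpow, ← ENNReal.rpow_neg, ← ENNReal.rpow_add _ _ hB0 hBt,
            show -q + (q - 1) = -1 by ring, ENNReal.rpow_neg_one]
  have hAEm : AEMeasurable (fun z : α × α => ‖f z.1 - f z.2‖ₑ ^ q)
      ((μ.restrict S).prod (μ.restrict B)) :=
    (hfS.comp_fst.sub hfB.aestronglyMeasurable.comp_snd).enorm.pow_const q
  calc ∫⁻ x in S, ‖f x - ⨍ y in B, f y ∂μ‖ₑ ^ q ∂μ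
      ≤ ∫⁻ x in S, (μ B)⁻¹ * ∫⁻ y in B, ‖f x - f y‖ₑ ^ q ∂μ ∂μ := lintegral_mono fun x => hpt x
    _ = (μ B)⁻¹ * ∫⁻ x in S, ∫⁻ y in B, ‖f x - f y‖ₑ ^ q ∂μ ∂μ :=
        lintegral_const_mul' _ _ (ENNReal.inv_ne_top.2 hB0)
    _ = (μ B)⁻¹ * ∫⁻ z, ‖f z.1 - f z.2‖ₑ ^ q ∂((μ.restrict S).prod (μ.restrict B)) := by
        rw [lintegral_prod _ hAEm]

/-- **From two-point estimates to deviations from an average.** For `0 < μ B < ∞`,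
`1 ≤ p ≤ ∞`, `f` integrable on `B` and a.e.-strongly measurable on `S`:
`‖f - ⨍_B f‖_{L^p(S)} ≤ μ(B)^{-1/p} ‖(x, y) ↦ f x - f y‖_{L^p(S × B)}` (Jensen for `p < ∞`;
for `p = ∞` almost every section of an essentially bounded function is essentially bounded).
This is the averaging step in the proof of the Poincaré inequality on star-shaped domains
(Gilbarg–Trudinger, proof of (7.45); Maz'ya §1.1.11). [folklore] -/
theorem eLpNorm_sub_setAverage_le_of_prod [SFinite μ] {S B : Set α} (hB0 : μ B ≠ 0)
    (hBt : μ B ≠ ∞)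
    {f : α → F} (hfB : IntegrableOn f B μ) (hfS : AEStronglyMeasurable f (μ.restrict S))
    {p : ℝ≥0∞} (hp : 1 ≤ p) :
    eLpNorm (fun x => f x - ⨍ y in B, f y ∂μ) p (μ.restrict S) ≤
      (μ B)⁻¹ ^ (1 / p.toReal) *
        eLpNorm (fun z : α × α => f z.1 - f z.2) p ((μ.restrict S).prod (μ.restrict B)) := by
  have hp0 : p ≠ 0 := (zero_lt_one.trans_le hp).ne'
  rcases eq_or_ne p ∞ with rfl | hptop
  · -- `p = ∞`
    simp only [ENNReal.toReal_top, div_zero, ENNReal.rpow_zero, one_mul, eLpNorm_exponent_top]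
    set M := eLpNormEssSup (fun z : α × α => f z.1 - f z.2) ((μ.restrict S).prod (μ.restrict B))
    have hM : ∀ᵐ z ∂(μ.restrict S).prod (μ.restrict B), ‖f z.1 - f z.2‖ₑ ≤ M :=
      enorm_ae_le_eLpNormEssSup _ _
    have hM' := Measure.ae_ae_of_ae_prod hM
    refine eLpNormEssSup_le_of_ae_enorm_bound ?_
    filter_upwards [hM'] with x hx
    calc ‖f x - ⨍ y in B, f y ∂μ‖ₑ ≤ (μ B)⁻¹ * ∫⁻ y in B, ‖f x - f y‖ₑ ∂μ :=
          enorm_sub_setAverage_le hB0 hBt hfB (f x)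
      _ ≤ (μ B)⁻¹ * ∫⁻ _ in B, M ∂μ := by gcongr 1; exact lintegral_mono_ae hx
      _ = M := by
          rw [lintegral_const, Measure.restrict_apply_univ, mul_comm M, ← mul_assoc,
            ENNReal.inv_mul_cancel hB0 hBt, one_mul]
  · -- `p < ∞`
    have hq : 1 ≤ p.toReal := by
      simpa using (ENNReal.toReal_le_toReal ENNReal.one_ne_top hptop).2 hp
    have hq0 : 0 ≤ 1 / p.toReal := by positivity
    simp only [eLpNorm_eq_lintegral_rpow_enorm_toReal hp0 hptop]
    calc (∫⁻ x, ‖f x - ⨍ y in B, f y ∂μ‖ₑ ^ p.toReal ∂μ.restrict S) ^ (1 / p.toReal)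
        ≤ ((μ B)⁻¹ * ∫⁻ z, ‖f z.1 - f z.2‖ₑ ^ p.toReal ∂((μ.restrict S).prod (μ.restrict B))) ^
            (1 / p.toReal) :=
          ENNReal.rpow_le_rpow (lintegral_enorm_sub_setAverage_rpow_le hB0 hBt hfB hfS hq) hq0
      _ = (μ B)⁻¹ ^ (1 / p.toReal) * (∫⁻ z, ‖f z.1 - f z.2‖ₑ ^ p.toReal
            ∂((μ.restrict S).prod (μ.restrict B))) ^ (1 / p.toReal) :=
          ENNReal.mul_rpow_of_nonneg _ _ hq0

end Averaging

/-! ### Two auxiliary facts: Haar scaling of `lintegral`, and `ess sup` of continuous maps -/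

section Haar

variable {E : Type*} [NormedAddCommGroup E] [NormedSpace ℝ E] [FiniteDimensional ℝ E]
  [MeasurableSpace E] [BorelSpace E] (μ : Measure E) [μ.IsAddHaarMeasure]

/-- Change of variables `x ↦ c x + w` in a Lebesgue integral against an additive Haar measure:
`∫ H(c x + w) dx = |c|^{-n} ∫ H`, `n = dim E` (Mathlib's `Measure.map_addHaar_smul` and
translation invariance). [folklore] -/
theorem lintegral_comp_smul_add {H : E → ℝ≥0∞} (hH : Measurable H) {c : ℝ} (hc : c ≠ 0)
    (w : E) :
    ∫⁻ x, H (c • x + w) ∂μ = ENNReal.ofReal |(c ^ Module.finrank ℝ E)⁻¹| * ∫⁻ x, H x ∂μ :=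
  calc ∫⁻ x, H (c • x + w) ∂μ = ∫⁻ y, H (y + w) ∂(Measure.map (fun x => c • x) μ) :=
        (lintegral_map (hH.comp (measurable_id.add_const w)) (measurable_const_smul c)).symm
    _ = ENNReal.ofReal |(c ^ Module.finrank ℝ E)⁻¹| * ∫⁻ y, H (y + w) ∂μ := by
        rw [Measure.map_addHaar_smul μ hc, lintegral_smul_measure, smul_eq_mul]
    _ = ENNReal.ofReal |(c ^ Module.finrank ℝ E)⁻¹| * ∫⁻ x, H x ∂μ := by
        rw [lintegral_add_right_eq_self H w]

omit [MeasurableSpace E] [BorelSpace E] [FiniteDimensional ℝ E] in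
/-- For `1/2 ≤ c` the Jacobian factor `|c^{-n}|` is at most `2^n`. [folklore] -/
theorem ofReal_abs_inv_pow_le_two_pow {c : ℝ} (hc : 1 / 2 ≤ c) (n : ℕ) :
    ENNReal.ofReal |(c ^ n)⁻¹| ≤ 2 ^ n := by
  have hc0 : 0 < c := by linarith
  have h1 : |(c ^ n)⁻¹| = c⁻¹ ^ n := by
    rw [abs_of_pos (inv_pos.2 (pow_pos hc0 n)), inv_pow]
  have h2 : c⁻¹ ≤ 2 := by
    rw [inv_le_comm₀ hc0 two_pos]; linarith
  calc ENNReal.ofReal |(c ^ n)⁻¹| = ENNReal.ofReal (c⁻¹ ^ n) := by rw [h1]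
    _ ≤ ENNReal.ofReal (2 ^ n) :=
        ENNReal.ofReal_le_ofReal (pow_le_pow_left₀ (inv_nonneg.2 hc0.le) h2 n)
    _ = 2 ^ n := by
        rw [ENNReal.ofReal_pow zero_le_two, ENNReal.ofReal_ofNat]

/-- For `1/2 ≤ c` and any `w`: `∫ H(c x + w) dx ≤ 2^n ∫ H`, `n = dim E`. Applied with
`c = 1 - t`, `w = t y` (`t ≤ 1/2`) and with `c = t`, `w = (1 - t) x` (`t ≥ 1/2`) this is the
Jacobian bound in the proof of the Poincaré inequality on star-shaped domains
(Gilbarg–Trudinger, proof of Lemma 7.16). [folklore] -/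
theorem lintegral_comp_smul_add_le {H : E → ℝ≥0∞} (hH : Measurable H) {c : ℝ} (hc : 1 / 2 ≤ c)
    (w : E) :
    ∫⁻ x, H (c • x + w) ∂μ ≤ 2 ^ Module.finrank ℝ E * ∫⁻ x, H x ∂μ := by
  rw [lintegral_comp_smul_add μ hH (by linarith : c ≠ 0) w]
  gcongr
  exact ofReal_abs_inv_pow_le_two_pow hc _

end Haar

section EssSup

variable {X : Type*} [TopologicalSpace X] [MeasurableSpace X] [OpensMeasurableSpace X]
  {ν : Measure X} [ν.IsOpenPosMeasure] {G : Type*} [NormedAddCommGroup G]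

/-- A continuous function is bounded by its essential supremum at every point of an open set,
for a measure positive on nonempty open sets. [folklore] -/
theorem enorm_le_eLpNormEssSup_of_continuous {h : X → G} (hh : Continuous h) {A : Set X}
    (hA : IsOpen A) {z : X} (hz : z ∈ A) :
    ‖h z‖ₑ ≤ eLpNormEssSup h (ν.restrict A) := by
  by_contra hlt
  push Not at hlt
  set M := eLpNormEssSup h (ν.restrict A)
  have hO : IsOpen (A ∩ {w | M < ‖h w‖ₑ}) := hA.inter (isOpen_lt continuous_const hh.enorm)
  have hpos : 0 < ν (A ∩ {w | M < ‖h w‖ₑ}) := hO.measure_pos ν ⟨z, hz, hlt⟩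
  have hae : ∀ᵐ w ∂ν.restrict A, ‖h w‖ₑ ≤ M := enorm_ae_le_eLpNormEssSup h _
  rw [ae_iff, Measure.restrict_apply' hA.measurableSet] at hae
  simp only [not_le] at hae
  rw [inter_comm] at hpos
  exact hpos.ne' hae

end EssSup

/-! ### The two-point estimate for `C¹` functions -/

section Smooth

variable {E : Type*} [NormedAddCommGroup E] [NormedSpace ℝ E] [FiniteDimensional ℝ E]
  [MeasurableSpace E] [BorelSpace E] {μ : Measure E} [μ.IsAddHaarMeasure]
variable {F : Type*} [NormedAddCommGroup F] [NormedSpace ℝ F] [CompleteSpace F]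

omit [FiniteDimensional ℝ E] [MeasurableSpace E] [BorelSpace E] in
/-- **Pointwise potential estimate** (Gilbarg–Trudinger, proof of Lemma 7.16; Maz'ya §1.1.10,
(3)): for `u ∈ C¹`, `q ≥ 1` and `‖y - x‖ ≤ d`,
`‖u x - u y‖^q ≤ d^q ∫₀¹ ‖Du(x + t(y - x))‖^q dt` (fundamental theorem of calculus along the
segment and Jensen's inequality on `[0, 1]`). [folklore] -/
theorem enorm_sub_rpow_le_lintegral_fderiv {u : E → F} (hu : ContDiff ℝ 1 u) (x y : E) {d : ℝ}
    (hd : ‖y - x‖ ≤ d) {q : ℝ} (hq : 1 ≤ q) :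
    ‖u x - u y‖ₑ ^ q ≤ ENNReal.ofReal d ^ q *
      ∫⁻ t in Ioc (0 : ℝ) 1, ‖fderiv ℝ u (x + t • (y - x))‖ₑ ^ q := by
  have hq0 : 0 ≤ q := by linarith
  set γ : ℝ → E := fun t => x + t • (y - x) with hγ
  have hγc : Continuous γ := continuous_const.add (continuous_id.smul continuous_const)
  have hDuc : Continuous (fderiv ℝ u) := hu.continuous_fderiv one_ne_zero
  have hγd : ∀ t, HasDerivAt γ (y - x) t := fun t => by
    have h := ((hasDerivAt_id' t).smul_const (y - x)).const_add x
    rwa [one_smul] at h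
  have hcomp : ∀ t, HasDerivAt (u ∘ γ) (fderiv ℝ u (γ t) (y - x)) t := fun t =>
    ((hu.differentiable one_ne_zero) (γ t)).hasFDerivAt.comp_hasDerivAt t (hγd t)
  have hint : IntervalIntegrable (fun t => fderiv ℝ u (γ t) (y - x)) volume 0 1 :=
    ((hDuc.comp hγc).clm_apply continuous_const).intervalIntegrable 0 1
  have hftc : ∫ t in (0 : ℝ)..1, fderiv ℝ u (γ t) (y - x) = u y - u x := by
    rw [intervalIntegral.integral_eq_sub_of_hasDerivAt (fun t _ => hcomp t) hint]
    simp [hγ]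
  -- `‖u x - u y‖ ≤ d ∫₀¹ ‖Du(γ t)‖`
  have hmeas : Measurable fun t => ‖fderiv ℝ u (γ t)‖ₑ := (hDuc.comp hγc).enorm.measurable
  have h1 : ‖u x - u y‖ₑ ≤ ENNReal.ofReal d * ∫⁻ t in Ioc (0 : ℝ) 1, ‖fderiv ℝ u (γ t)‖ₑ := by
    rw [enorm_sub_rev, ← hftc, intervalIntegral.integral_of_le zero_le_one]
    refine (enorm_integral_le_lintegral_enorm _).trans ?_
    calc ∫⁻ t in Ioc (0 : ℝ) 1, ‖fderiv ℝ u (γ t) (y - x)‖ₑ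
        ≤ ∫⁻ t in Ioc (0 : ℝ) 1, ‖fderiv ℝ u (γ t)‖ₑ * ENNReal.ofReal d := by
          refine lintegral_mono fun t => ?_
          refine (ContinuousLinearMap.le_opENorm _ _).trans ?_
          gcongr
          rw [← ofReal_norm]
          exact ENNReal.ofReal_le_ofReal hd
      _ = ENNReal.ofReal d * ∫⁻ t in Ioc (0 : ℝ) 1, ‖fderiv ℝ u (γ t)‖ₑ := by
          rw [lintegral_mul_const _ hmeas, mul_comm]
  -- Jensen on `[0, 1]`
  have hJ := UnboundedOperators.lintegral_mul_rpow_le_of_one_le (μ := volume.restrict (Ioc (0 : ℝ) 1))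
    (K := fun _ => 1) (F := fun t => ‖fderiv ℝ u (γ t)‖ₑ) aemeasurable_const
    hmeas.aemeasurable hq
  simp only [one_mul, lintegral_const, Measure.restrict_apply_univ, Real.volume_Ioc, sub_zero,
    ENNReal.ofReal_one, ENNReal.one_rpow] at hJ
  calc ‖u x - u y‖ₑ ^ q ≤ (ENNReal.ofReal d * ∫⁻ t in Ioc (0 : ℝ) 1, ‖fderiv ℝ u (γ t)‖ₑ) ^ q :=
        ENNReal.rpow_le_rpow h1 hq0
    _ = ENNReal.ofReal d ^ q * (∫⁻ t in Ioc (0 : ℝ) 1, ‖fderiv ℝ u (γ t)‖ₑ) ^ q :=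
        ENNReal.mul_rpow_of_nonneg _ _ hq0
    _ ≤ ENNReal.ofReal d ^ q * ∫⁻ t in Ioc (0 : ℝ) 1, ‖fderiv ℝ u (γ t)‖ₑ ^ q := by gcongr

/-- **Two-point estimate for `C¹` functions, `1 ≤ q < ∞`** (Gilbarg–Trudinger, proof of
Lemma 7.16 and (7.45); Maz'ya §1.1.10, Theorem 1). Let `B ⊆ A` be measurable sets such that
`A` contains every segment from a point of `B` to a point of `A`, and `‖y - x‖ ≤ d` for
`x ∈ A`, `y ∈ B`. Then for `u ∈ C¹(E; F)`,
`∫_{A × B} ‖u x - u y‖^q ≤ d^q 2^n μ(A) ∫_A ‖Du‖^q`, `n = dim E`: integrate the pointwise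
estimate, exchange the order of integration, and change variables `x ↦ (1-t)x + ty`
(Jacobian `(1-t)^{-n} ≤ 2^n` for `t ≤ 1/2`) resp. `y ↦ (1-t)x + ty` (Jacobian `t^{-n} ≤ 2^n`
for `t ≥ 1/2`). [cite: Mazja1985, §1.1.10 Theorem 1] -/
theorem lintegral_prod_enorm_sub_rpow_le_of_contDiff {u : E → F} (hu : ContDiff ℝ 1 u)
    {A B : Set E} (hA : MeasurableSet A) (hB : MeasurableSet B) (hBA : B ⊆ A)
    (hseg : ∀ x ∈ A, ∀ y ∈ B, segment ℝ x y ⊆ A) {d : ℝ} (hd : ∀ x ∈ A, ∀ y ∈ B, ‖y - x‖ ≤ d)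
    {q : ℝ} (hq : 1 ≤ q) :
    ∫⁻ z, ‖u z.1 - u z.2‖ₑ ^ q ∂((μ.restrict A).prod (μ.restrict B)) ≤
      ENNReal.ofReal d ^ q * 2 ^ Module.finrank ℝ E * μ A *
        ∫⁻ x in A, ‖fderiv ℝ u x‖ₑ ^ q ∂μ := by
  have hq0 : 0 ≤ q := by linarith
  set n := Module.finrank ℝ E with hn
  have hDuc : Continuous (fderiv ℝ u) := hu.continuous_fderiv one_ne_zero
  -- the integrand `H = 𝟙_A ‖Du‖^q`
  set H : E → ℝ≥0∞ := A.indicator fun z => ‖fderiv ℝ u z‖ₑ ^ q with hH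
  have hHm : Measurable H := (hDuc.enorm.measurable.pow_const q).indicator hA
  have hHint : ∫⁻ x, H x ∂μ = ∫⁻ x in A, ‖fderiv ℝ u x‖ₑ ^ q ∂μ := lintegral_indicator hA _
  -- the transported integrand on `(E × E) × ℝ`
  set Φ : (E × E) × ℝ → ℝ≥0∞ := fun w => H (w.1.1 + w.2 • (w.1.2 - w.1.1)) with hΦ
  have hΦm : Measurable Φ := by
    refine hHm.comp ?_
    exact (measurable_fst.comp measurable_fst).add
      (measurable_snd.smul ((measurable_snd.comp measurable_fst).sub
        (measurable_fst.comp measurable_fst)))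
  set ν := (μ.restrict A).prod (μ.restrict B) with hν
  -- Step 1: pointwise estimate, with `‖Du‖^q` replaced by `H` along the segment
  have step1 : ∀ᵐ z ∂ν, ‖u z.1 - u z.2‖ₑ ^ q ≤
      ENNReal.ofReal d ^ q * ∫⁻ t in Ioc (0 : ℝ) 1, Φ (z, t) := by
    have hmem : ∀ᵐ z ∂ν, z ∈ A ×ˢ B := by
      rw [hν, Measure.prod_restrict]
      exact ae_restrict_mem (hA.prod hB)
    filter_upwards [hmem] with z hz
    obtain ⟨hx, hy⟩ := hz
    refine (enorm_sub_rpow_le_lintegral_fderiv hu z.1 z.2 (hd _ hx _ hy) hq).trans ?_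
    gcongr 1
    refine setLIntegral_mono' measurableSet_Ioc fun t ht => le_of_eq ?_
    have hzt : z.1 + t • (z.2 - z.1) ∈ A := by
      refine hseg _ hx _ hy ?_
      rw [segment_eq_image']
      exact mem_image_of_mem _ ⟨ht.1.le, ht.2⟩
    simp only [hΦ, hH, indicator_of_mem hzt]
  -- Step 2: the inner integral in `z` for fixed `t` is at most `2^n μ(A) ∫ H`
  have step2 : ∀ t ∈ Ioc (0 : ℝ) 1, ∫⁻ z, Φ (z, t) ∂ν ≤ 2 ^ n * μ A * ∫⁻ x, H x ∂μ := by
    intro t ht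
    have hΦt : Measurable fun z : E × E => Φ (z, t) :=
      hΦm.comp (measurable_id.prodMk measurable_const)
    rcases le_or_gt t (1 / 2) with ht2 | ht2
    · -- `t ≤ 1/2`: integrate first in `x`, `x ↦ (1 - t) x + t y` has Jacobian `≥ 2^{-n}`
      calc ∫⁻ z, Φ (z, t) ∂ν = ∫⁻ y in B, ∫⁻ x in A, Φ ((x, y), t) ∂μ ∂μ :=
            lintegral_prod_symm _ hΦt.aemeasurable
        _ ≤ ∫⁻ y in B, ∫⁻ x, Φ ((x, y), t) ∂μ ∂μ :=
            lintegral_mono fun y => lintegral_mono' Measure.restrict_le_self le_rfl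
        _ = ∫⁻ y in B, ∫⁻ x, H ((1 - t) • x + t • y) ∂μ ∂μ := by
            congr 1 with y; congr 1 with x
            simp only [hΦ]
            congr 1
            module
        _ ≤ ∫⁻ y in B, 2 ^ n * ∫⁻ x, H x ∂μ ∂μ := by
            refine lintegral_mono fun y => ?_
            exact lintegral_comp_smul_add_le μ hHm (by linarith) _
        _ = 2 ^ n * μ B * ∫⁻ x, H x ∂μ := by
            rw [lintegral_const, Measure.restrict_apply_univ]; ring
        _ ≤ 2 ^ n * μ A * ∫⁻ x, H x ∂μ := by gcongr
    · -- `t > 1/2`: integrate first in `y`, `y ↦ (1 - t) x + t y` has Jacobian `≥ 2^{-n}`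
      calc ∫⁻ z, Φ (z, t) ∂ν = ∫⁻ x in A, ∫⁻ y in B, Φ ((x, y), t) ∂μ ∂μ :=
            lintegral_prod _ hΦt.aemeasurable
        _ ≤ ∫⁻ x in A, ∫⁻ y, Φ ((x, y), t) ∂μ ∂μ :=
            lintegral_mono fun x => lintegral_mono' Measure.restrict_le_self le_rfl
        _ = ∫⁻ x in A, ∫⁻ y, H (t • y + (1 - t) • x) ∂μ ∂μ := by
            congr 1 with x; congr 1 with y
            simp only [hΦ]
            congr 1
            module
        _ ≤ ∫⁻ x in A, 2 ^ n * ∫⁻ x, H x ∂μ ∂μ := by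
            refine lintegral_mono fun x => ?_
            exact lintegral_comp_smul_add_le μ hHm ht2.le _
        _ = 2 ^ n * μ A * ∫⁻ x, H x ∂μ := by
            rw [lintegral_const, Measure.restrict_apply_univ]; ring
  -- Step 3: integrate Step 1, exchange the integrals, and use Step 2
  calc ∫⁻ z, ‖u z.1 - u z.2‖ₑ ^ q ∂ν
      ≤ ∫⁻ z, ENNReal.ofReal d ^ q * (∫⁻ t in Ioc (0 : ℝ) 1, Φ (z, t)) ∂ν :=
        lintegral_mono_ae step1
    _ = ENNReal.ofReal d ^ q * ∫⁻ z, (∫⁻ t in Ioc (0 : ℝ) 1, Φ (z, t)) ∂ν :=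
        lintegral_const_mul' _ _ (ENNReal.rpow_ne_top_of_nonneg hq0 ENNReal.ofReal_ne_top)
    _ = ENNReal.ofReal d ^ q * ∫⁻ t in Ioc (0 : ℝ) 1, (∫⁻ z, Φ (z, t) ∂ν) := by
        rw [lintegral_lintegral_swap hΦm.aemeasurable]
    _ ≤ ENNReal.ofReal d ^ q * ∫⁻ _ in Ioc (0 : ℝ) 1, 2 ^ n * μ A * ∫⁻ x, H x ∂μ := by
        gcongr 1
        exact setLIntegral_mono' measurableSet_Ioc step2
    _ = ENNReal.ofReal d ^ q * 2 ^ n * μ A * ∫⁻ x in A, ‖fderiv ℝ u x‖ₑ ^ q ∂μ := by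
        rw [lintegral_const, Measure.restrict_apply_univ, Real.volume_Ioc, sub_zero,
          ENNReal.ofReal_one, mul_one, hHint]
        ring

omit [CompleteSpace F] in
/-- **Two-point estimate for `C¹` functions, `p = ∞`**: with `A` open, `B ⊆ A`, segments from
`B` to `A` inside `A` and `‖y - x‖ ≤ d`, the mean value inequality along segments gives
`ess sup_{A × B} ‖u x - u y‖ ≤ d · ess sup_A ‖Du‖` (a continuous `Du` is bounded by its
essential supremum on the open set `A`). [folklore] -/
theorem eLpNormEssSup_prod_sub_le_of_contDiff {u : E → F} (hu : ContDiff ℝ 1 u) {A B : Set E}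
    (hA : IsOpen A) (hB : MeasurableSet B)
    (hseg : ∀ x ∈ A, ∀ y ∈ B, segment ℝ x y ⊆ A) {d : ℝ} (hd0 : 0 < d)
    (hd : ∀ x ∈ A, ∀ y ∈ B, ‖y - x‖ ≤ d) :
    eLpNormEssSup (fun z : E × E => u z.1 - u z.2) ((μ.restrict A).prod (μ.restrict B)) ≤
      ENNReal.ofReal d * eLpNormEssSup (fderiv ℝ u) (μ.restrict A) := by
  set M := eLpNormEssSup (fderiv ℝ u) (μ.restrict A) with hM
  rcases eq_or_ne M ∞ with hMt | hMt
  · rw [hMt, ENNReal.mul_top (ENNReal.ofReal_pos.2 hd0).ne']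
    exact le_top
  have hDuc : Continuous (fderiv ℝ u) := hu.continuous_fderiv one_ne_zero
  have hbound : ∀ z ∈ A, ‖fderiv ℝ u z‖ ≤ M.toReal := fun z hz => by
    rw [← toReal_enorm]  -- `‖a‖ = ‖a‖ₑ.toReal`
    exact ENNReal.toReal_mono hMt (enorm_le_eLpNormEssSup_of_continuous hDuc hA hz)
  have hpt : ∀ x ∈ A, ∀ y ∈ B, ‖u x - u y‖ₑ ≤ ENNReal.ofReal d * M := by
    intro x hx y hy
    have hmv : ‖u y - u x‖ ≤ M.toReal * ‖y - x‖ :=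
      (convex_segment x y).norm_image_sub_le_of_norm_fderiv_le
        (fun z _ => (hu.differentiable one_ne_zero z))
        (fun z hz => hbound z (hseg x hx y hy hz)) (left_mem_segment ℝ x y)
        (right_mem_segment ℝ x y)
    rw [enorm_sub_rev, ← ofReal_norm, ← ENNReal.ofReal_toReal hMt,
      ← ENNReal.ofReal_mul hd0.le]
    refine ENNReal.ofReal_le_ofReal (hmv.trans ?_)
    rw [mul_comm]
    exact mul_le_mul_of_nonneg_right (hd x hx y hy) ENNReal.toReal_nonneg
  refine eLpNormEssSup_le_of_ae_enorm_bound ?_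
  have hmem : ∀ᵐ z ∂(μ.restrict A).prod (μ.restrict B), z ∈ A ×ˢ B := by
    rw [Measure.prod_restrict]
    exact ae_restrict_mem (hA.measurableSet.prod hB)
  filter_upwards [hmem] with z hz
  exact hpt z.1 hz.1 z.2 hz.2

/-- **Two-point estimate for `C¹` functions, all `1 ≤ p ≤ ∞`** (Gilbarg–Trudinger, proof of
Lemma 7.16; Maz'ya §1.1.10, Theorem 1): with `A` open, `B ⊆ A` measurable, segments from `B`
to `A` inside `A`, and `‖y - x‖ ≤ d` (`d > 0`) for `x ∈ A`, `y ∈ B`,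
`‖(x, y) ↦ u x - u y‖_{L^p(A × B)} ≤ d · 2^{n/p} μ(A)^{1/p} ‖Du‖_{L^p(A)}` (`n = dim E`; for
`p = ∞` the exponents `n/p`, `1/p` are `0`). [cite: Mazja1985, §1.1.10 Theorem 1] -/
theorem eLpNorm_prod_sub_le_of_contDiff {u : E → F} (hu : ContDiff ℝ 1 u) {A B : Set E}
    (hA : IsOpen A) (hB : MeasurableSet B) (hBA : B ⊆ A)
    (hseg : ∀ x ∈ A, ∀ y ∈ B, segment ℝ x y ⊆ A) {d : ℝ} (hd0 : 0 < d)
    (hd : ∀ x ∈ A, ∀ y ∈ B, ‖y - x‖ ≤ d) {p : ℝ≥0∞} (hp : 1 ≤ p) :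
    eLpNorm (fun z : E × E => u z.1 - u z.2) p ((μ.restrict A).prod (μ.restrict B)) ≤
      ENNReal.ofReal d * 2 ^ ((Module.finrank ℝ E : ℝ) / p.toReal) * μ A ^ (1 / p.toReal) *
        eLpNorm (fderiv ℝ u) p (μ.restrict A) := by
  have hp0 : p ≠ 0 := (zero_lt_one.trans_le hp).ne'
  rcases eq_or_ne p ∞ with rfl | hptop
  · simp only [ENNReal.toReal_top, div_zero, ENNReal.rpow_zero, mul_one, eLpNorm_exponent_top]
    exact eLpNormEssSup_prod_sub_le_of_contDiff hu hA hB hseg hd0 hd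
  have hq : 1 ≤ p.toReal := by
    simpa using (ENNReal.toReal_le_toReal ENNReal.one_ne_top hptop).2 hp
  have hq0' : 0 < p.toReal := by linarith
  have hq0 : 0 ≤ 1 / p.toReal := by positivity
  rw [eLpNorm_eq_lintegral_rpow_enorm_toReal hp0 hptop,
    eLpNorm_eq_lintegral_rpow_enorm_toReal hp0 hptop]
  calc (∫⁻ z, ‖u z.1 - u z.2‖ₑ ^ p.toReal ∂(μ.restrict A).prod (μ.restrict B)) ^ (1 / p.toReal)
      ≤ (ENNReal.ofReal d ^ p.toReal * 2 ^ Module.finrank ℝ E * μ A *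
          ∫⁻ x in A, ‖fderiv ℝ u x‖ₑ ^ p.toReal ∂μ) ^ (1 / p.toReal) :=
        ENNReal.rpow_le_rpow
          (lintegral_prod_enorm_sub_rpow_le_of_contDiff hu hA.measurableSet hB hBA hseg hd hq) hq0
    _ = ENNReal.ofReal d * 2 ^ ((Module.finrank ℝ E : ℝ) / p.toReal) * μ A ^ (1 / p.toReal) *
          (∫⁻ x in A, ‖fderiv ℝ u x‖ₑ ^ p.toReal ∂μ) ^ (1 / p.toReal) := by
        rw [ENNReal.mul_rpow_of_nonneg _ _ hq0, ENNReal.mul_rpow_of_nonneg _ _ hq0,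
          ENNReal.mul_rpow_of_nonneg _ _ hq0, ← ENNReal.rpow_mul, mul_one_div, div_self hq0'.ne',
          ENNReal.rpow_one, ← ENNReal.rpow_natCast, ← ENNReal.rpow_mul, mul_one_div]

end Smooth

/-! ### Inner parallel sets of a domain star-shaped with respect to a ball -/

section Parallel

variable {E : Type*} [NormedAddCommGroup E]

/-- The inner parallel set `U_δ = {x | closedBall x (δ + ε) ⊆ U for some ε > 0}` is open.
[folklore] -/
theorem isOpen_innerParallel (U : Set E) (δ : ℝ) :
    IsOpen {x : E | ∃ ε > (0 : ℝ), closedBall x (δ + ε) ⊆ U} := by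
  refine Metric.isOpen_iff.2 fun x ⟨ε, hε, hxU⟩ => ⟨ε / 2, half_pos hε, fun x' hx' => ?_⟩
  refine ⟨ε / 2, half_pos hε, Subset.trans (closedBall_subset_closedBall' ?_) hxU⟩
  rw [mem_ball] at hx'
  linarith [hx'.le]

/-- `U_δ ⊆ U` for `δ ≥ 0`. [folklore] -/
theorem innerParallel_subset {U : Set E} {δ : ℝ} (hδ : 0 ≤ δ) :
    {x : E | ∃ ε > (0 : ℝ), closedBall x (δ + ε) ⊆ U} ⊆ U :=
  fun _ ⟨_, hε, hxU⟩ => hxU (mem_closedBall_self (by positivity))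

/-- Points of `U_δ` keep closed balls of radius `ρ ≤ δ` inside `U`. [folklore] -/
theorem closedBall_subset_of_mem_innerParallel {U : Set E} {δ ρ : ℝ} (hρ : ρ ≤ δ) {x : E}
    (hx : x ∈ {x : E | ∃ ε > (0 : ℝ), closedBall x (δ + ε) ⊆ U}) : closedBall x ρ ⊆ U := by
  obtain ⟨ε, hε, hxU⟩ := hx
  exact (closedBall_subset_closedBall (by linarith)).trans hxU

/-- A ball `B(a, r')` with `r' + δ < r` lies in `U_δ` when `B(a, r) ⊆ U`. [folklore] -/
theorem ball_subset_innerParallel {U : Set E} {a : E} {r r' δ : ℝ} (hr : r' + δ < r)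
    (haU : ball a r ⊆ U) : ball a r' ⊆ {x : E | ∃ ε > (0 : ℝ), closedBall x (δ + ε) ⊆ U} := by
  intro y hy
  refine ⟨(r - r' - δ) / 2, by linarith, fun w hw => haU ?_⟩
  rw [mem_ball] at hy ⊢
  rw [mem_closedBall] at hw
  linarith [dist_triangle w y a]

/-- Every point of an open set `U` lies in `U_δ` for all small `δ > 0`. [folklore] -/
theorem eventually_mem_innerParallel {U : Set E} (hU : IsOpen U) {x : E} (hx : x ∈ U)
    {δ : ℕ → ℝ} (hδ : Tendsto δ atTop (𝓝 0)) :
    ∀ᶠ k in atTop, x ∈ {x : E | ∃ ε > (0 : ℝ), closedBall x (δ k + ε) ⊆ U} := by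
  obtain ⟨ε₀, hε₀, hxU⟩ := nhds_basis_closedBall.mem_iff.1 (hU.mem_nhds hx)
  filter_upwards [(tendsto_order.1 hδ).2 ε₀ hε₀] with k hk
  exact ⟨ε₀ - δ k, by linarith, by rw [add_sub_cancel]; exact hxU⟩

variable [NormedSpace ℝ E]

/-- **Inner parallel sets inherit star-shapedness** (Maz'ya §1.1.8: a domain star-shaped with
respect to a ball): if `U` is star-shaped with respect to every point of `B(a, r)` and
`r' + δ < r`, `δ ≥ 0`, then `U_δ` is star-shaped with respect to every point of `B(a, r')`:
translating a segment from `y ∈ B(a, r')` to `x ∈ U_δ` by a vector of length `≤ δ + ε` gives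
a segment from a point of `B(a, r)` to a point of `U`. [folklore] -/
theorem starConvex_innerParallel {U : Set E} {a : E} {r r' δ : ℝ} (hr : r' + δ < r)
    (hstar : ∀ y ∈ ball a r, StarConvex ℝ y U) :
    ∀ y ∈ ball a r', StarConvex ℝ y {x : E | ∃ ε > (0 : ℝ), closedBall x (δ + ε) ⊆ U} := by
  intro y hy x hx a' b' ha' hb' hab'
  obtain ⟨ε, hε, hxU⟩ := hx
  set ε' := min ε ((r - r' - δ) / 2) with hε'
  have hε'0 : 0 < ε' := lt_min hε (by linarith)
  have hxU' : closedBall x (δ + ε') ⊆ U :=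
    (closedBall_subset_closedBall (by linarith [min_le_left ε ((r - r' - δ) / 2)])).trans hxU
  refine ⟨ε', hε'0, fun w hw => ?_⟩
  set v := w - (a' • y + b' • x) with hv
  have hvn : ‖v‖ ≤ δ + ε' := by rwa [mem_closedBall, dist_eq_norm] at hw
  have hw' : w = a' • (y + v) + b' • (x + v) := by
    have : a' • v + b' • v = v := by rw [← add_smul, hab', one_smul]
    rw [smul_add, smul_add, add_add_add_comm, this, hv]
    abel
  have hyv : y + v ∈ ball a r := by
    rw [mem_ball] at hy ⊢
    calc dist (y + v) a ≤ dist (y + v) y + dist y a := dist_triangle _ _ _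
      _ = ‖v‖ + dist y a := by rw [dist_eq_norm, add_sub_cancel_left]
      _ < r := by linarith [min_le_right ε ((r - r' - δ) / 2)]
  have hxv : x + v ∈ U :=
    hxU' (by rw [mem_closedBall, dist_eq_norm, add_sub_cancel_left]; exact hvn)
  rw [hw']
  exact hstar _ hyv hxv ha' hb' hab'

end Parallel

/-! ### The two-point estimate for functions with a weak derivative -/

section Weak

variable {E : Type*} [NormedAddCommGroup E] [InnerProductSpace ℝ E] [FiniteDimensional ℝ E]
  [MeasurableSpace E] [BorelSpace E] {μ : Measure E} [μ.IsAddHaarMeasure]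
variable {F : Type*} [NormedAddCommGroup F] [NormedSpace ℝ F] [CompleteSpace F]

/-- **Two-point estimate for Sobolev functions on a domain star-shaped with respect to a ball**
(Maz'ya, *Sobolev Spaces*, §1.1.10, Theorem 1 with §1.1.11, proof of the Lemma;
Gilbarg–Trudinger (7.45)). Let `U` be a bounded open set containing `B(a, r)` and star-shaped
with respect to every point of `B(a, r)`, and let `f` have the weak derivative `g` on `U`,
both integrable on `U`. Then for `1 ≤ p ≤ ∞`, writing `f̃ = 𝟙_U f`, `B = B(a, r/2)`,
`d = diam U + 1`, `n = dim E`: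
`‖(x, y) ↦ f̃ x - f̃ y‖_{L^p(U × B)} ≤ d · 2^{n/p} μ(U)^{1/p} ‖g‖_{L^p(U)}`.
Proof: apply `eLpNorm_prod_sub_le_of_contDiff` to the interior mollifications
`φ_N ⋆ 𝟙_U f` on the inner parallel sets `U_δ ⊇ B` (star-shaped with respect to `B`), where
their derivatives are controlled by `‖g‖_{L^p(U)}`
(`HasWeakFDerivOn.eLpNorm_fderiv_normed_convolution_indicator_le`); let `N → ∞` (a.e.
convergence of mollifications and Fatou's lemma in `L^p`) and then `δ → 0` (Fatou again).
[cite: Mazja1985, §1.1.10 Theorem 1 and §1.1.11 Lemma] -/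
theorem eLpNorm_prod_sub_le_of_hasWeakFDerivOn {U : Opens E}
    (hUb : Bornology.IsBounded (U : Set E)) {a : E} {r : ℝ} (hr : 0 < r)
    (haU : ball a r ⊆ U) (hstar : ∀ y ∈ ball a r, StarConvex ℝ y (U : Set E))
    {f : E → F} {g : E → E →L[ℝ] F} (hw : HasWeakFDerivOn U μ f g) (hf : IntegrableOn f U μ)
    (hg : IntegrableOn g U μ) {p : ℝ≥0∞} (hp : 1 ≤ p) :
    eLpNorm (fun z : E × E => (U : Set E).indicator f z.1 - (U : Set E).indicator f z.2) p
        ((μ.restrict U).prod (μ.restrict (ball a (r / 2)))) ≤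
      ENNReal.ofReal (diam (U : Set E) + 1) * 2 ^ ((Module.finrank ℝ E : ℝ) / p.toReal) *
        μ U ^ (1 / p.toReal) * eLpNorm g p (μ.restrict U) := by
  -- notation
  have hUo : IsOpen (U : Set E) := U.isOpen
  have hUm : MeasurableSet (U : Set E) := hUo.measurableSet
  set d : ℝ := diam (U : Set E) + 1 with hd
  have hd0 : 0 < d := by have := diam_nonneg (s := (U : Set E)); linarith
  set B : Set E := ball a (r / 2) with hB
  have hBm : MeasurableSet B := isOpen_ball.measurableSet
  set K : ℝ≥0∞ := ENNReal.ofReal d * 2 ^ ((Module.finrank ℝ E : ℝ) / p.toReal) *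
    μ U ^ (1 / p.toReal) * eLpNorm g p (μ.restrict U) with hK
  set fU : E → F := (U : Set E).indicator f with hfU
  have hfUi : Integrable fU μ := hf.integrable_indicator hUm
  have hfUl : LocallyIntegrable fU μ := hfUi.locallyIntegrable
  have hfUm : AEStronglyMeasurable fU μ := hfUi.aestronglyMeasurable
  set h : E × E → F := fun z => fU z.1 - fU z.2 with hh
  have hhm : AEStronglyMeasurable h (μ.prod μ) := hfUm.comp_fst.sub hfUm.comp_snd
  -- distances inside `U`
  have hdU : ∀ x ∈ (U : Set E), ∀ y ∈ (U : Set E), ‖y - x‖ ≤ d := fun x hx y hy => by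
    rw [← dist_eq_norm]
    exact (dist_le_diam_of_mem hUb hy hx).trans (by linarith)
  -- mollifiers
  obtain ⟨φ, hφ0, hφ2⟩ := exists_contDiffBump_seq (E := E)
  set uN : ℕ → E → F := fun N => (φ N).normed μ ⋆[lsmul ℝ ℝ, μ] fU with huN
  have hu1 : ∀ N, ContDiff ℝ 1 (uN N) := fun N =>
    (φ N).hasCompactSupport_normed.contDiff_convolution_left _ (φ N).contDiff_normed hfUl
  have hae : ∀ᵐ x ∂μ, Tendsto (fun N => uN N x) atTop (𝓝 (fU x)) :=
    ContDiffBump.ae_convolution_tendsto_right_of_locallyIntegrable hφ0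
      (Eventually.of_forall hφ2) hfUl
  -- inner parallel sets `U_k = U_{δ_k}`, `δ_k = (r/4)/(k+1)`
  set δ : ℕ → ℝ := fun k => r / 4 * (1 / ((k : ℝ) + 1)) with hδ
  have hδpos : ∀ k, 0 < δ k := fun k => by positivity
  have hδle : ∀ k, δ k ≤ r / 4 := fun k => by
    have h1 : 1 / ((k : ℝ) + 1) ≤ 1 := by
      rw [div_le_one (by positivity)]; linarith [k.cast_nonneg (α := ℝ)]
    calc δ k = r / 4 * (1 / ((k : ℝ) + 1)) := rfl
      _ ≤ r / 4 * 1 := by gcongr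
      _ = r / 4 := mul_one _
  have hδ0 : Tendsto δ atTop (𝓝 0) := by
    have h := tendsto_one_div_add_atTop_nhds_zero_nat.const_mul (r / 4)
    rw [mul_zero] at h
    exact h
  set Uk : ℕ → Set E := fun k => {x : E | ∃ ε > (0 : ℝ), closedBall x (δ k + ε) ⊆ U} with hUk
  have hUko : ∀ k, IsOpen (Uk k) := fun k => isOpen_innerParallel _ _
  have hUkm : ∀ k, MeasurableSet (Uk k) := fun k => (hUko k).measurableSet
  have hUkU : ∀ k, Uk k ⊆ U := fun k => innerParallel_subset (hδpos k).le
  have hrk : ∀ k, r / 2 + δ k < r := fun k => by linarith [hδle k]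
  have hBUk : ∀ k, B ⊆ Uk k := fun k => ball_subset_innerParallel (hrk k) haU
  have hstark : ∀ k, ∀ y ∈ B, StarConvex ℝ y (Uk k) := fun k =>
    starConvex_innerParallel (hrk k) hstar
  have hsegk : ∀ k, ∀ x ∈ Uk k, ∀ y ∈ B, segment ℝ x y ⊆ Uk k := fun k x hx y hy => by
    rw [segment_symm]
    exact (hstark k y hy).segment_subset hx
  -- Step A: the estimate on `U_k × B` for the limit function
  have stepA : ∀ k, eLpNorm h p ((μ.restrict (Uk k)).prod (μ.restrict B)) ≤ K := by
    intro k
    set ν := (μ.restrict (Uk k)).prod (μ.restrict B) with hν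
    -- for large `N`, the smooth estimate for `u_N` on `U_k`
    have hev : ∀ᶠ N in atTop, (φ N).rOut < δ k := (tendsto_order.1 hφ0).2 _ (hδpos k)
    have hbd : ∀ᶠ N in atTop, eLpNorm (fun z : E × E => uN N z.1 - uN N z.2) p ν ≤ K := by
      filter_upwards [hev] with N hN
      calc eLpNorm (fun z : E × E => uN N z.1 - uN N z.2) p ν
          ≤ ENNReal.ofReal d * 2 ^ ((Module.finrank ℝ E : ℝ) / p.toReal) *
              μ (Uk k) ^ (1 / p.toReal) * eLpNorm (fderiv ℝ (uN N)) p (μ.restrict (Uk k)) :=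
            eLpNorm_prod_sub_le_of_contDiff (hu1 N) (hUko k) hBm (hBUk k) (hsegk k) hd0
              (fun x hx y hy => hdU x (hUkU k hx) y (hUkU k (hBUk k hy))) hp
        _ ≤ K := by
            rw [hK]
            gcongr ?_ * ?_
            · exact mul_le_mul_right
                (ENNReal.rpow_le_rpow (measure_mono (hUkU k)) (by positivity)) _
            · exact hw.eLpNorm_fderiv_normed_convolution_indicator_le hf hg (φ N) (hUkm k)
                (fun x hx => closedBall_subset_of_mem_innerParallel hN.le hx) hp
    -- a.e. convergence on `U_k × B`
    have hlim : ∀ᵐ z ∂ν, Tendsto (fun N => uN N z.1 - uN N z.2) atTop (𝓝 (h z)) := by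
      have h1 : ∀ᵐ z ∂ν, Tendsto (fun N => uN N z.1) atTop (𝓝 (fU z.1)) :=
        Measure.quasiMeasurePreserving_fst.ae (ae_restrict_of_ae hae)
      have h2 : ∀ᵐ z ∂ν, Tendsto (fun N => uN N z.2) atTop (𝓝 (fU z.2)) :=
        Measure.quasiMeasurePreserving_snd.ae (ae_restrict_of_ae hae)
      filter_upwards [h1, h2] with z hz1 hz2 using hz1.sub hz2
    have hmeasN : ∀ N, AEStronglyMeasurable (fun z : E × E => uN N z.1 - uN N z.2) ν := fun N =>
      (((hu1 N).continuous.comp continuous_fst).sub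
        ((hu1 N).continuous.comp continuous_snd)).aestronglyMeasurable
    exact Lp.eLpNorm_le_of_ae_tendsto hbd hmeasN hlim
  -- Step B: `k → ∞` by Fatou for the indicators of `U_k × B` on `μ ⊗ μ`
  have hprod : ∀ S : Set E, MeasurableSet S →
      eLpNorm h p ((μ.restrict S).prod (μ.restrict B)) =
        eLpNorm ((S ×ˢ B).indicator h) p (μ.prod μ) :=
    fun S hS => by rw [Measure.prod_restrict, eLpNorm_indicator_eq_eLpNorm_restrict (hS.prod hBm)]
  have hlimk : ∀ z, Tendsto (fun k => (Uk k ×ˢ B).indicator h z) atTop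
      (𝓝 (((U : Set E) ×ˢ B).indicator h z)) := by
    intro z
    by_cases hz : z ∈ (U : Set E) ×ˢ B
    · have hevk := eventually_mem_innerParallel hUo hz.1 hδ0
      refine (tendsto_const_nhds (x := ((U : Set E) ×ˢ B).indicator h z)).congr' ?_
      filter_upwards [hevk] with k hk
      rw [indicator_of_mem hz, indicator_of_mem (show z ∈ Uk k ×ˢ B from ⟨hk, hz.2⟩)]
    · have hzk : ∀ k, z ∉ Uk k ×ˢ B := fun k hz' => hz ⟨hUkU k hz'.1, hz'.2⟩
      simp only [indicator_of_notMem hz, indicator_of_notMem (hzk _)]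
      exact tendsto_const_nhds
  change eLpNorm h p ((μ.restrict U).prod (μ.restrict B)) ≤ K
  rw [hprod _ hUm]
  exact Lp.eLpNorm_le_of_ae_tendsto
    (Eventually.of_forall fun k => by rw [← hprod _ (hUkm k)]; exact stepA k)
    (fun k => hhm.indicator ((hUkm k).prod hBm)) (ae_of_all _ hlimk)

/-- **Poincaré inequality on a bounded domain star-shaped with respect to a ball**
(Maz'ya, *Sobolev Spaces*, §1.1.11, Lemma: `‖u - ū‖_{L_p(Ω)} ≤ C ‖∇u‖_{L_p(Ω)}` for a domain
star-shaped with respect to a ball; Gilbarg–Trudinger (7.45) for convex domains; here for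
Banach-space valued functions and `1 ≤ p ≤ ∞`). If `U` is bounded, open, contains `B(a, r)`
and is star-shaped with respect to every point of `B(a, r)`, then there is `C < ∞` (depending
on `U`, `a`, `r`, `p`, `μ` only) with `‖f - ⨍_U f‖_{L^p(U)} ≤ C ‖g‖_{L^p(U)}` for every
`f ∈ L^p(U)` with weak derivative `g` on `U`. Proof: the two-point estimate
`eLpNorm_prod_sub_le_of_hasWeakFDerivOn`, the averaging lemma
`eLpNorm_sub_setAverage_le_of_prod` over `B(a, r/2)`, and
`‖f - ⨍_U f‖ ≤ 2 ‖f - ⨍_B f‖` (`Literature.Analysis.FunctionSpaces.eLpNorm_sub_setAverage_le_two_mul`).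
[cite: Mazja1985, §1.1.11 Lemma] -/
theorem poincare_starShaped {U : Opens E} (hUb : Bornology.IsBounded (U : Set E)) {a : E}
    {r : ℝ} (hr : 0 < r) (haU : ball a r ⊆ U)
    (hstar : ∀ y ∈ ball a r, StarConvex ℝ y (U : Set E)) {p : ℝ≥0∞} (hp : 1 ≤ p) :
    ∃ C : ℝ≥0∞, C ≠ ∞ ∧ ∀ (f : E → F) (g : E → E →L[ℝ] F), MemLp f p (μ.restrict U) →
      HasWeakFDerivOn U μ f g →
      eLpNorm (fun x => f x - ⨍ y in (U : Set E), f y ∂μ) p (μ.restrict U) ≤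
        C * eLpNorm g p (μ.restrict U) := by
  have hUo : IsOpen (U : Set E) := U.isOpen
  have hUm : MeasurableSet (U : Set E) := hUo.measurableSet
  have hμU : μ U ≠ ∞ := hUb.measure_lt_top.ne
  haveI : IsFiniteMeasure (μ.restrict U) := isFiniteMeasure_restrict.2 hμU
  set B : Set E := ball a (r / 2) with hB
  have hBU : B ⊆ U := (ball_subset_ball (by linarith)).trans haU
  have hB0 : μ B ≠ 0 := (measure_ball_pos μ a (half_pos hr)).ne'
  have hBt : μ B ≠ ∞ := measure_ne_top_of_subset hBU hμU
  set K₀ : ℝ≥0∞ := ENNReal.ofReal (diam (U : Set E) + 1) *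
    2 ^ ((Module.finrank ℝ E : ℝ) / p.toReal) * μ U ^ (1 / p.toReal) with hK₀
  set C' : ℝ≥0∞ := 2 * ((μ B)⁻¹ ^ (1 / p.toReal) * K₀) with hC'
  have hq0 : 0 ≤ 1 / p.toReal := by positivity
  have hK₀t : K₀ ≠ ∞ := by
    refine ENNReal.mul_ne_top (ENNReal.mul_ne_top ENNReal.ofReal_ne_top ?_) ?_
    · exact ENNReal.rpow_ne_top_of_nonneg (by positivity) (by simp)
    · exact ENNReal.rpow_ne_top_of_nonneg hq0 hμU
  have hC't : C' ≠ ∞ := by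
    refine ENNReal.mul_ne_top (by simp) (ENNReal.mul_ne_top ?_ hK₀t)
    exact ENNReal.rpow_ne_top_of_nonneg hq0 (ENNReal.inv_ne_top.2 hB0)
  refine ⟨max C' 1, by simp [hC't], fun f g hf hw => ?_⟩
  have hC0 : max C' 1 ≠ 0 := (lt_of_lt_of_le one_pos (le_max_right _ _)).ne'
  -- the case `‖g‖_{L^p(U)} = ∞` is trivial
  rcases eq_or_ne (eLpNorm g p (μ.restrict U)) ∞ with hgt | hgt
  · rw [hgt, ENNReal.mul_top hC0]; exact le_top
  -- otherwise `f`, `g` are integrable on `U`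
  have hgLp : MemLp g p (μ.restrict U) :=
    ⟨hw.locallyIntegrableOn_deriv.aestronglyMeasurable, hgt.lt_top⟩
  have hgI : IntegrableOn g U μ := hgLp.integrable hp
  have hfI : IntegrableOn f U μ := hf.integrable hp
  set fU : E → F := (U : Set E).indicator f with hfU
  have hfUi : Integrable fU μ := hfI.integrable_indicator hUm
  have heq : ∀ x ∈ (U : Set E), fU x = f x := fun x hx => indicator_of_mem hx _
  -- two-point estimate and averaging over `B`
  have h2pt := eLpNorm_prod_sub_le_of_hasWeakFDerivOn hUb hr haU hstar hw hfI hgI hp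
  have havg := eLpNorm_sub_setAverage_le_of_prod (S := (U : Set E)) hB0 hBt hfUi.integrableOn
    hfUi.aestronglyMeasurable.restrict hp
  -- replace `𝟙_U f` by `f` on `U`
  have havgU : ⨍ y in (U : Set E), fU y ∂μ = ⨍ y in (U : Set E), f y ∂μ :=
    setAverage_congr_fun hUm (ae_of_all _ heq)
  have hcongr : eLpNorm (fun x => f x - ⨍ y in (U : Set E), f y ∂μ) p (μ.restrict U) =
      eLpNorm (fun x => fU x - ⨍ y in (U : Set E), fU y ∂μ) p (μ.restrict U) := by
    refine eLpNorm_congr_ae ?_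
    filter_upwards [ae_restrict_mem hUm] with x hx
    rw [heq x hx, havgU]
  calc eLpNorm (fun x => f x - ⨍ y in (U : Set E), f y ∂μ) p (μ.restrict U)
      = eLpNorm (fun x => fU x - ⨍ y in (U : Set E), fU y ∂μ) p (μ.restrict U) := hcongr
    _ ≤ 2 * eLpNorm (fun x => fU x - ⨍ y in B, fU y ∂μ) p (μ.restrict U) :=
        eLpNorm_sub_setAverage_le_two_mul hμU hp hfUi.integrableOn _
    _ ≤ 2 * ((μ B)⁻¹ ^ (1 / p.toReal) * (K₀ * eLpNorm g p (μ.restrict U))) := by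
        gcongr 2 * ?_
        exact havg.trans (mul_le_mul_right (by simpa only [hK₀, mul_assoc] using h2pt) _)
    _ = C' * eLpNorm g p (μ.restrict U) := by rw [hC']; ring
    _ ≤ max C' 1 * eLpNorm g p (μ.restrict U) := by gcongr; exact le_max_left C' 1

end Weak

/-! ### Assembly: the Poincaré–Wirtinger inequality on bounded connected Lipschitz domains -/

section Assembly

open ENNReal Bornology
open scoped InnerProductSpace

variable {E' : Type*} [NormedAddCommGroup E'] [InnerProductSpace ℝ E']
  [MeasurableSpace E'] [BorelSpace E'] [FiniteDimensional ℝ E']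
variable {F : Type*} [NormedAddCommGroup F] [NormedSpace ℝ F] [CompleteSpace F]

/-- **Discharge of `Literature.Analysis.FunctionSpaces.poincare_wirtinger`: the Poincaré–Wirtinger inequality on bounded
connected Lipschitz domains** (Evans, *PDE*, §5.8.1, Theorem 1, there for `C¹` boundaries and
real-valued functions; here for Lipschitz boundaries, `1 ≤ p ≤ ∞` and Banach-space valued
functions, following Maz'ya, *Sobolev Spaces*, §1.1.11, Lemma with §1.1.9, Lemma 1): cover `Ω`
by finitely many pieces star-shaped with respect to balls, apply the Poincaré inequality on
each piece to the restrictions of `f` and of its weak derivative `g`, and glue.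
[cite: Evans2010, §5.8.1 Theorem 1] [cite: Mazja1985, §1.1.11 Lemma] -/
theorem poincare_wirtinger_holds : poincare_wirtinger (E' := E') (F := F) := by
  intro Ω hΩ hb hc p hp μ _
  have hμΩ : μ (Ω : Set E') ≠ ∞ := hb.measure_lt_top.ne
  haveI : IsFiniteMeasure (μ.restrict (Ω : Set E')) := isFiniteMeasure_restrict.2 hμΩ
  -- Step 1: the finite cover by pieces star-shaped with respect to balls
  obtain ⟨s, V, hΩV, hV⟩ := hΩ.exists_finite_starConvex_cover hb
  have hcov : (Ω : Set E') = ⋃ i : ↥s, V (i : E') := by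
    rw [hΩV]; ext y; simp
  have hVo : ∀ i : ↥s, IsOpen (V (i : E')) := fun i => (hV i i.2).1
  have hVΩ : ∀ i : ↥s, V (i : E') ⊆ (Ω : Set E') := fun i => by
    rw [hcov]; exact subset_iUnion (fun j : ↥s => V (j : E')) i
  -- Step 2: the Poincaré inequality on each piece
  have hpiece : ∀ i : ↥s, ∃ C : ℝ≥0∞, C ≠ ∞ ∧ ∀ (f : E' → F) (g : E' → E' →L[ℝ] F),
      MemLp f p (μ.restrict (V (i : E'))) → HasWeakFDerivOn ⟨V (i : E'), hVo i⟩ μ f g →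
      eLpNorm (fun x => f x - ⨍ y in V (i : E'), f y ∂μ) p (μ.restrict (V (i : E'))) ≤
        C * eLpNorm g p (μ.restrict (V (i : E'))) := by
    intro i
    obtain ⟨hVo', hVb, b, ρ, hρ, hbV, hstar⟩ := hV i i.2
    exact poincare_starShaped (U := ⟨V (i : E'), hVo'⟩) hVb hρ hbV hstar hp
  choose C hC hPC using hpiece
  -- Step 3: gluing along chains of pieces (connectedness of `Ω`)
  obtain ⟨K, hK, hglue⟩ := exists_eLpNorm_sub_setAverage_le_of_finite_cover (μ := μ) (F := F)
    (fun i : ↥s => V (i : E')) hVo hcov hc.isPreconnected hμΩ hp C hC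
  refine ⟨K.toNNReal, fun f g hf hw => ?_⟩
  rw [ENNReal.coe_toNNReal hK]
  refine hglue f _ (hf.memLp.integrable hp) fun i => ?_
  have hle : μ.restrict (V (i : E')) ≤ μ.restrict (Ω : Set E') :=
    Measure.restrict_mono_set μ (hVΩ i)
  have hfi : MemLp f p (μ.restrict (V (i : E'))) := hf.memLp.mono_measure hle
  have hwi : HasWeakFDerivOn ⟨V (i : E'), hVo i⟩ μ f g :=
    HasWeakFDerivOn.mono_set_holds hw (show (⟨V (i : E'), hVo i⟩ : Opens E') ≤ Ω from hVΩ i)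
  calc eLpNorm (fun x => f x - ⨍ y in V (i : E'), f y ∂μ) p (μ.restrict (V (i : E')))
      ≤ C i * eLpNorm g p (μ.restrict (V (i : E'))) := hPC i f g hfi hwi
    _ ≤ C i * eLpNorm g p (μ.restrict (Ω : Set E')) :=
        mul_le_mul_right (eLpNorm_mono_measure _ hle) _

end Assembly

end Literature.Analysis.FunctionSpaces
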